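import Mathlib
import Literature.NumberTheory.Transcendental.KZCalculusProofs
import Literature.NumberTheory.Transcendental.KZLogCalculusProofs
import Literature.NumberTheory.Transcendental.KZSemiCanonicalReductionProofs
import Literature.NumberTheory.Transcendental.KZSemialgebraicComplex
import Literature.NumberTheory.Transcendental.KZDirichletPeeling
import Literature.NumberTheory.Transcendental.KZBallPeelingAux

/-!
# OffTetraSectorKernel (stmt-KontsevichZagierPeriods-10557), line odd-hyperbolic-ladder: stub stub_cornerSimplexClass

THE VOLUME OF THE CORNER SIMPLEX INSIDE THE CALCULUS (Hilbert's-third-problem input of the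
weight-one envelope). For every dimension `d` and every real algebraic constant `c`,
`[Δ_d, c] ≡ [pt, c/d!]` modulo Kontsevich–Zagier relations, where
`Δ_d = {x : Fin d → ℝ | (∀ i, 0 < x i) ∧ Σ x i < 1}` is the open corner simplex and `[pt, a]` a
representation of dimension `0` (domain `univ = {pt}`, integrand `a`).

Proof (Newton–Leibniz induction along the last coordinate). We prove, by induction on `k`, the
weighted statement

  `[Δ_k, c (1 − Σ x)^j / j!] ≡ [pt, c / (k + j)!]`   for all `j`,

and take `j = 0`.
* `k = 0`: `Δ_0 = univ` is the point and `c (1 − 0)^j / j! = c / j!`; two representations of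
  dimension `0` with the same domain and the same integrand on it differ by a relation
  (`KZ.of_sub_of_mem_relations_of_eqOn`, rule (1b)).
* `k + 1 → k`: the fibre of `Δ_{k+1}` over `x ∈ Δ_k` in the last coordinate is `(0, 1 − Σ xᵢ)`.
  (i) `[Δ_{k+1}, g_j] ≡ [B, g_j]` for the CLOSED band `B = {z | init z ∈ Δ_k, 0 ≤ z_last ≤ 1 − Σ init z}`,
  since `Δ_{k+1} ⊆ B` and `B ∖ Δ_{k+1}` lies in the null union of the hyperplanes `{z_last = 0}` and
  `{Σ z = 1}` (rule (1a), `KZ.of_sub_of_mem_relations_of_null`);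
  (ii) ONE Newton–Leibniz move (rule (3), `KZ.newtonLeibnizRel`) over the base `Δ_k` with
  `a = 0`, `b x = 1 − Σ xᵢ` and the polynomial primitive `F z = −c (1 − Σ z)^{j+1} / (j+1)!`
  (`∂F/∂z_last = c (1 − Σ z)^j / j!`, `F (x, b x) − F (x, 0) = c (1 − Σ x)^{j+1} / (j+1)!`) gives
  `[B, g_j] ≡ [Δ_k, g_{j+1}]`;
  (iii) the induction hypothesis at `(k, j + 1)`, as `k + (j + 1) = (k + 1) + j`.
All integrands are `c`·(polynomial over `ℚ`), hence `ℚ`-semialgebraic (`c` is `ℚ`-definable); all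
domains lie in the unit cube, so continuity gives absolute integrability.

References: M. Kontsevich, D. Zagier, *Periods* (2001), §1.2, rules (1), (3).
-/

noncomputable section

open Set MeasureTheory
open Literature.NumberTheory.Transcendental
open Literature.ModelTheory.ExponentialFields (IsSemialgebraic isSemialgebraic_setOf_eval_le)
open MvPolynomial (aeval X C)

namespace Summit.KontsevichZagierPeriods.HyperbolicBloch.OffTetraSectorKernel

/-! ### Bookkeeping: the simplex and the closed band lie in the unit cube -/

/-- The open corner simplex `Δ_n` lies in the closed unit cube. [folklore] -/
theorem corner_simplex_subset_Icc (n : ℕ) :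
    {x : Fin n → ℝ | (∀ i, 0 < x i) ∧ ∑ i, x i < 1} ⊆ Icc 0 1 := by
  rintro x ⟨hpos, hsum⟩
  refine ⟨fun i => (hpos i).le, fun i => ?_⟩
  have h : x i ≤ ∑ l, x l :=
    Finset.single_le_sum (f := x) (fun l _ => (hpos l).le) (Finset.mem_univ i)
  exact h.trans hsum.le

/-- The closed band `{z | init z ∈ Δ_k, 0 ≤ z_last ≤ 1 − Σ init z}` over the corner simplex lies in
the closed unit cube. [folklore] -/
theorem corner_simplex_band_subset_Icc (k : ℕ) :
    {z : Fin (k + 1) → ℝ | Fin.init z ∈ {x : Fin k → ℝ | (∀ i, 0 < x i) ∧ ∑ i, x i < 1} ∧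
      0 ≤ z (Fin.last k) ∧ z (Fin.last k) ≤ 1 - ∑ i, Fin.init z i} ⊆ Icc 0 1 := by
  rintro z ⟨⟨hpos, hsum⟩, h0, h1⟩
  have hnn : 0 ≤ ∑ i, Fin.init z i := Finset.sum_nonneg fun i _ => (hpos i).le
  refine ⟨fun i => ?_, fun i => ?_⟩
  · refine Fin.lastCases ?_ (fun l => ?_) i
    · exact h0
    · exact (hpos l).le
  · refine Fin.lastCases ?_ (fun l => ?_) i
    · show z (Fin.last k) ≤ 1
      linarith
    · have h : Fin.init z l ≤ ∑ i, Fin.init z i :=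
        Finset.single_le_sum (f := Fin.init z) (fun i _ => (hpos i).le) (Finset.mem_univ l)
      show z (Fin.castSucc l) ≤ 1
      exact h.trans hsum.le

/-- A continuous function is absolutely integrable on any subset of the closed unit cube.
[folklore] -/
theorem corner_simplex_integrableOn {n : ℕ} {s : Set (Fin n → ℝ)} (hs : s ⊆ Icc 0 1)
    {f : (Fin n → ℝ) → ℝ} (hf : Continuous f) : IntegrableOn f s volume :=
  (hf.continuousOn.integrableOn_compact isCompact_Icc).mono_set hs

/-! ### Semialgebraicity -/

/-- `x ↦ c · P(x)` is a `ℚ`-semialgebraic function on a `ℚ`-semialgebraic set for a real algebraic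
constant `c` and a polynomial `P` over `ℚ` (product of semialgebraic functions).
[cite: BochnakCosteRoy1998, Prop. 2.2.6] -/
theorem corner_simplex_isSemialgebraicFunOn_const_mul_aeval {n : ℕ} {s : Set (Fin n → ℝ)}
    (hs : IsSemialgebraic ℚ s) {c : ℝ} (hc : IsAlgebraic ℚ c) (P : MvPolynomial (Fin n) ℚ) :
    IsSemialgebraicFunOn ℚ s (fun x => c * aeval x P) :=
  (IsSemialgebraicFunOn.mul_holds (isSemialgebraicFunOn_const_of_isAlgebraic hs hc)
    (isSemialgebraicFunOn_aeval hs P)).congr fun _ _ => rfl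

/-- The weighted integrand `x ↦ c (1 − Σ xᵢ)^j / j!` is `ℚ`-semialgebraic on every
`ℚ`-semialgebraic set, for `c` real algebraic. [cite: BochnakCosteRoy1998, Prop. 2.2.6] -/
theorem corner_simplex_isSemialgebraicFunOn_weight {n : ℕ} {s : Set (Fin n → ℝ)}
    (hs : IsSemialgebraic ℚ s) {c : ℝ} (hc : IsAlgebraic ℚ c) (j : ℕ) :
    IsSemialgebraicFunOn ℚ s (fun x => c * (1 - ∑ i, x i) ^ j / (j.factorial : ℝ)) := by
  refine (corner_simplex_isSemialgebraicFunOn_const_mul_aeval hs hc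
    (C ((j.factorial : ℚ)⁻¹) * ((1 : MvPolynomial (Fin n) ℚ) - ∑ i, X i) ^ j)).congr fun x _ => ?_
  simp only [map_mul, map_pow, map_sub, map_one, map_sum, MvPolynomial.aeval_X,
    MvPolynomial.aeval_C, eq_ratCast, Rat.cast_inv, Rat.cast_natCast]
  ring

/-- The closed band `{z | init z ∈ Δ_k, 0 ≤ z_last ≤ 1 − Σ init z}` is `ℚ`-semialgebraic.
[folklore] -/
theorem corner_simplex_isSemialgebraic_band (k : ℕ) :
    IsSemialgebraic ℚ {z : Fin (k + 1) → ℝ |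
      Fin.init z ∈ {x : Fin k → ℝ | (∀ i, 0 < x i) ∧ ∑ i, x i < 1} ∧
        0 ≤ z (Fin.last k) ∧ z (Fin.last k) ≤ 1 - ∑ i, Fin.init z i} := by
  have h1 := (KZ.isSemialgebraic_dirichletSimplex k).setOf_init_mem
  have h2 := isSemialgebraic_setOf_eval_le (k := ℚ) (R := ℝ)
    (0 : MvPolynomial (Fin (k + 1)) ℚ) (X (Fin.last k))
  have h3 := isSemialgebraic_setOf_eval_le (k := ℚ) (R := ℝ)
    (X (Fin.last k) : MvPolynomial (Fin (k + 1)) ℚ) (1 - ∑ i : Fin k, X (Fin.castSucc i))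
  convert h1.inter (h2.inter h3) using 1
  ext z
  simp only [mem_setOf_eq, mem_inter_iff, map_zero, map_sub, map_one, map_sum,
    MvPolynomial.aeval_X]
  rfl

/-! ### Null hyperplanes -/

/-- The hyperplane `{Σ zᵢ = 1}` of `ℝⁿ` is Lebesgue-null (zero set of a non-zero polynomial).
[cite: CaronTraynor2005, Theorem (p. 1)] -/
theorem corner_simplex_volume_setOf_sum_eq_one (n : ℕ) :
    volume {z : Fin n → ℝ | ∑ i, z i = 1} = 0 := by
  have hne : MvPolynomial.map (algebraMap ℚ ℝ) ((1 : MvPolynomial (Fin n) ℚ) - ∑ i, X i) ≠ 0 := by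
    intro h
    have h' := congrArg (MvPolynomial.eval (0 : Fin n → ℝ)) h
    simp at h'
  have hset : {z : Fin n → ℝ | ∑ i, z i = 1} =
      {z | aeval z ((1 : MvPolynomial (Fin n) ℚ) - ∑ i, X i) = 0} := by
    ext z
    simp only [mem_setOf_eq, map_sub, map_one, map_sum, MvPolynomial.aeval_X, sub_eq_zero]
    exact eq_comm
  rw [hset]
  exact volume_setOf_aeval_eq_zero _ hne

/-! ### The representations -/

/-- The weighted simplex representation `[Δ_k, c (1 − Σ x)^j / j!]` exists (semialgebraic data;
integrable: continuous on a subset of the unit cube). [cite: KontsevichZagier2001, §1.1] -/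
theorem corner_simplex_exists_simplexRep {c : ℝ} (hc : IsAlgebraic ℚ c) (k j : ℕ) :
    ∃ S : KZ.IntegralRep k, S.domain = {x | (∀ i, 0 < x i) ∧ ∑ i, x i < 1} ∧
      S.integrand = fun x => c * (1 - ∑ i, x i) ^ j / (j.factorial : ℝ) :=
  ⟨⟨_, _, KZ.isSemialgebraic_dirichletSimplex k,
    corner_simplex_isSemialgebraicFunOn_weight (KZ.isSemialgebraic_dirichletSimplex k) hc j,
    corner_simplex_integrableOn (corner_simplex_subset_Icc k) (by fun_prop)⟩, rfl, rfl⟩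

/-- The weighted band representation `[B, c (1 − Σ z)^j / j!]` on the closed band over `Δ_k`
exists (semialgebraic data; integrable: continuous on a subset of the unit cube).
[cite: KontsevichZagier2001, §1.1] -/
theorem corner_simplex_exists_bandRep {c : ℝ} (hc : IsAlgebraic ℚ c) (k j : ℕ) :
    ∃ R : KZ.IntegralRep (k + 1), R.domain = {z : Fin (k + 1) → ℝ |
      Fin.init z ∈ {x : Fin k → ℝ | (∀ i, 0 < x i) ∧ ∑ i, x i < 1} ∧
        0 ≤ z (Fin.last k) ∧ z (Fin.last k) ≤ 1 - ∑ i, Fin.init z i} ∧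
      R.integrand = fun z => c * (1 - ∑ i, z i) ^ j / (j.factorial : ℝ) :=
  ⟨⟨_, _, corner_simplex_isSemialgebraic_band k,
    corner_simplex_isSemialgebraicFunOn_weight (corner_simplex_isSemialgebraic_band k) hc j,
    corner_simplex_integrableOn (corner_simplex_band_subset_Icc k) (by fun_prop)⟩, rfl, rfl⟩

/-! ### The two moves of the induction step -/

/-- **Null modification** (rule (1a)): the weighted representation on the open simplex `Δ_{k+1}`
and the one on the closed band `B ⊇ Δ_{k+1}` differ by a relation, `B ∖ Δ_{k+1}` lying in the null
union of the hyperplanes `{z_last = 0}` (`KZ.BallPeeling.volume_setOf_apply_eq_const`) and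
`{Σ z = 1}`. [cite: KontsevichZagier2001, §1.2 rule (1)] -/
theorem corner_simplex_of_simplex_sub_of_band (k : ℕ) (S R : KZ.IntegralRep (k + 1))
    (hSd : S.domain = {x | (∀ i, 0 < x i) ∧ ∑ i, x i < 1})
    (hRd : R.domain = {z : Fin (k + 1) → ℝ |
      Fin.init z ∈ {x : Fin k → ℝ | (∀ i, 0 < x i) ∧ ∑ i, x i < 1} ∧
        0 ≤ z (Fin.last k) ∧ z (Fin.last k) ≤ 1 - ∑ i, Fin.init z i})
    (hSR : EqOn S.integrand R.integrand S.domain) :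
    KZ.of S - KZ.of R ∈ KZ.relations := by
  have hsub : S.domain ⊆ R.domain := by
    rw [hSd, hRd]
    rintro z ⟨hpos, hsum⟩
    rw [Fin.sum_univ_castSucc] at hsum
    have hl : 0 < z (Fin.last k) := hpos _
    refine ⟨⟨fun i => hpos _, ?_⟩, hl.le, ?_⟩
    · show ∑ i, z (Fin.castSucc i) < 1
      linarith
    · show z (Fin.last k) ≤ 1 - ∑ i, z (Fin.castSucc i)
      linarith
  refine KZ.of_sub_of_mem_relations_of_null S R ?_ ?_ fun z hz => hSR hz.1
  · exact measure_mono_null (fun z hz => (hz.2 (hsub hz.1)).elim) measure_empty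
  · refine measure_mono_null ?_ (measure_union_null
      (KZ.BallPeeling.volume_setOf_apply_eq_const (k + 1) (Fin.last k) 0)
      (corner_simplex_volume_setOf_sum_eq_one (k + 1)))
    intro z hz
    rw [hRd, hSd] at hz
    obtain ⟨⟨⟨hpos, hsum⟩, h0, h1⟩, hnot⟩ := hz
    simp only [mem_setOf_eq, not_and, not_lt] at hnot
    rcases h0.lt_or_eq with h0' | h0'
    · right
      have hall : ∀ i, 0 < z i := fun i => by
        refine Fin.lastCases ?_ (fun l => ?_) i
        · exact h0'
        · exact hpos l
      have hge := hnot hall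
      show ∑ i, z i = 1
      rw [Fin.sum_univ_castSucc] at hge ⊢
      have h1' : z (Fin.last k) ≤ 1 - ∑ i, z (Fin.castSucc i) := h1
      linarith
    · left
      exact h0'.symm

/-- **The Newton–Leibniz move** (rule (3)) along the last coordinate over the base `Δ_k`, with
`a = 0`, `b x = 1 − Σ xᵢ` and the polynomial primitive `F z = −c (1 − Σ z)^{j+1} / (j+1)!`:
`[B, c (1 − Σ z)^j / j!] ≡ [Δ_k, c (1 − Σ x)^{j+1} / (j+1)!]`.
[cite: KontsevichZagier2001, §1.2 rule (3)] -/
theorem corner_simplex_of_band_sub_of_simplex {c : ℝ} (hc : IsAlgebraic ℚ c) (k j : ℕ)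
    (R : KZ.IntegralRep (k + 1)) (S' : KZ.IntegralRep k)
    (hRd : R.domain = {z : Fin (k + 1) → ℝ |
      Fin.init z ∈ {x : Fin k → ℝ | (∀ i, 0 < x i) ∧ ∑ i, x i < 1} ∧
        0 ≤ z (Fin.last k) ∧ z (Fin.last k) ≤ 1 - ∑ i, Fin.init z i})
    (hRi : R.integrand = fun z => c * (1 - ∑ i, z i) ^ j / (j.factorial : ℝ))
    (hS'd : S'.domain = {x | (∀ i, 0 < x i) ∧ ∑ i, x i < 1})
    (hS'i : S'.integrand = fun x => c * (1 - ∑ i, x i) ^ (j + 1) / ((j + 1).factorial : ℝ)) :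
    KZ.of R - KZ.of S' ∈ KZ.relations := by
  have hΔ : IsSemialgebraic ℚ S'.domain := S'.isSemialgebraic_domain
  refine KZ.newtonLeibnizRel_subset_relations ⟨k, R, S', fun _ => 0, fun x => 1 - ∑ i, x i,
    fun z => -c * (1 - ∑ i, z i) ^ (j + 1) / ((j + 1).factorial : ℝ),
    ?_, ?_, ?_, ?_, ?_, ?_, ?_, ?_, rfl⟩
  · exact corner_simplex_isSemialgebraicFunOn_weight R.isSemialgebraic_domain hc.neg (j + 1)
  · exact (isSemialgebraicFunOn_aeval hΔ (0 : MvPolynomial (Fin k) ℚ)).congr fun x _ => by simp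
  · exact (isSemialgebraicFunOn_aeval hΔ ((1 : MvPolynomial (Fin k) ℚ) - ∑ i, X i)).congr
      fun x _ => by simp
  · intro x hx
    rw [hS'd] at hx
    linarith [hx.2]
  · rw [hRd, hS'd]
  · intro x _
    simp only [Fin.sum_univ_castSucc, Fin.snoc_castSucc, Fin.snoc_last]
    exact (by fun_prop : Continuous fun t : ℝ =>
      -c * (1 - (∑ i, x i + t)) ^ (j + 1) / ((j + 1).factorial : ℝ)).continuousOn
  · intro x _ t _
    simp only [hRi, Fin.sum_univ_castSucc, Fin.snoc_castSucc, Fin.snoc_last]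
    have hd : HasDerivAt (fun s : ℝ => 1 - (∑ i, x i + s)) (-1) t :=
      ((hasDerivAt_id' t).const_add (∑ i, x i)).const_sub 1
    refine (((hd.pow (j + 1)).const_mul (-c)).div_const ((j + 1).factorial : ℝ)).congr_deriv ?_
    rw [Nat.add_sub_cancel, Nat.factorial_succ]
    push_cast
    field_simp
  · intro x _
    simp only [hS'i, Fin.sum_univ_castSucc, Fin.snoc_castSucc, Fin.snoc_last]
    have h0 : (1 : ℝ) - (∑ i, x i + (1 - ∑ i, x i)) = 0 := by ring
    rw [h0, add_zero, zero_pow (Nat.succ_ne_zero j), mul_zero, zero_div, zero_sub]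
    ring

/-! ### The induction -/

/-- **Weighted corner-simplex volumes inside the calculus**: for real algebraic `c` and all `k, j`,
`[Δ_k, c (1 − Σ x)^j / j!] ≡ [pt, c / (k + j)!]` (induction on `k`: null modification, one
Newton–Leibniz move along the last coordinate, induction hypothesis at `(k, j + 1)`).
[cite: KontsevichZagier2001, §1.2 rules (1), (3)] -/
theorem corner_simplex_weight_sub_mem_relations (c : ℝ) (hc : IsAlgebraic ℚ c) :
    ∀ (k j : ℕ) (S : KZ.IntegralRep k) (Z : KZ.IntegralRep 0),
      S.domain = {x | (∀ i, 0 < x i) ∧ ∑ i, x i < 1} →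
      EqOn S.integrand (fun x => c * (1 - ∑ i, x i) ^ j / (j.factorial : ℝ)) S.domain →
      Z.domain = univ → (Z.integrand = fun _ => c / ((k + j).factorial : ℝ)) →
      KZ.of S - KZ.of Z ∈ KZ.relations
  | 0, j, S, Z, hSd, hSi, hZd, hZi => by
    refine KZ.of_sub_of_mem_relations_of_eqOn ?_ fun x hx => ?_
    · rw [hZd, hSd]
      ext x
      simp
    · rw [hSi hx, hZi]
      simp
  | k + 1, j, S, Z, hSd, hSi, hZd, hZi => by
    obtain ⟨R, hRd, hRi⟩ := corner_simplex_exists_bandRep hc k j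
    obtain ⟨S', hS'd, hS'i⟩ := corner_simplex_exists_simplexRep hc k (j + 1)
    -- (i) null modification `[S] ≡ [R]`
    have h1 : KZ.of S - KZ.of R ∈ KZ.relations :=
      corner_simplex_of_simplex_sub_of_band k S R hSd hRd fun z hz => by rw [hSi hz, hRi]
    -- (ii) one Newton–Leibniz move `[R] ≡ [S']`
    have h2 : KZ.of R - KZ.of S' ∈ KZ.relations :=
      corner_simplex_of_band_sub_of_simplex hc k j R S' hRd hRi hS'd hS'i
    -- (iii) the induction hypothesis at `(k, j + 1)`
    have e : k + 1 + j = k + (j + 1) := by omega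
    have h3 : KZ.of S' - KZ.of Z ∈ KZ.relations :=
      corner_simplex_weight_sub_mem_relations c hc k (j + 1) S' Z hS'd
        (fun x _ => by rw [hS'i]) hZd (by rw [hZi, e])
    have key : KZ.of S - KZ.of Z =
        (KZ.of S - KZ.of R) + (KZ.of R - KZ.of S') + (KZ.of S' - KZ.of Z) := by abel
    rw [key]
    exact add_mem (add_mem h1 h2) h3

/-! ### The stub -/

/-- STUB `stub_cornerSimplexClass`: THE VOLUME OF THE CORNER SIMPLEX INSIDE THE CALCULUS. For every
dimension `d` and real algebraic constant `c`, `[Δ_d, c] ≡ [pt, c/d!]` with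
`Δ_d = {x | xᵢ > 0, Σ xᵢ < 1}`: `d` Newton–Leibniz moves along the last coordinate (the fibre of
`Δ_{k+1}` over `x ∈ Δ_k` is `(0, 1 − Σ xᵢ)`; the integrands stay `c`·(polynomial over `ℚ`)), the
case `j = 0` of `corner_simplex_weight_sub_mem_relations`.
[cite: KontsevichZagier2001, §1.2 rules (1), (3)] -/
theorem stub_cornerSimplexClass :
    ∀ (d : ℕ) (c : ℝ), IsAlgebraic ℚ c →
    ∀ (S : KZ.IntegralRep d), S.domain = {x | (∀ i, 0 < x i) ∧ ∑ i, x i < 1} →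
      (∀ x ∈ S.domain, S.integrand x = c) →
    ∀ (Z : KZ.IntegralRep 0), Z.domain = univ → (Z.integrand = fun _ => c / (Nat.factorial d : ℝ)) →
      KZ.of S - KZ.of Z ∈ KZ.relations := by
  intro d c hc S hSd hSi Z hZd hZi
  exact corner_simplex_weight_sub_mem_relations c hc d 0 S Z hSd
    (fun x hx => by rw [hSi x hx]; simp) hZd (by rw [hZi, Nat.add_zero])

end Summit.KontsevichZagierPeriods.HyperbolicBloch.OffTetraSectorKernel

end
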